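import Summits.QuantumFields.YangMills.Theorems.UnitScaleTiltProp7LODCubeGaugeFamily
import Summits.QuantumFields.YangMills.Theorems.UnitScaleTiltProp7CubeCutoffGeometry
import Summits.QuantumFields.YangMills.Theorems.BalabanUVNodesN20LCSHullSeparation
import Literature.MathematicalPhysics.QuantumFieldTheory.Balaban1983to89.B13BondAveragingReadingNumerals
import Literature.MathematicalPhysics.QuantumFieldTheory.Balaban1983to89.B5Eq117TorusCarriers
import HarnessLib

/-!
# Route `UnitScaleTilt`, crux K1 «MinimiserStabilityRegPr» (stmt-QuantumFields-19200), EX row `hGF[Lift]` (curved member) — LOD LINE, PEN (L5″) `hloc` PER CUBE,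
# THE PER-CUBE DISCHARGE, STAGE G: **THE CUBE CUT-OFFS SIT INSIDE THE CUBE GAUGE'S FLAT ZONE** — from ✓`Prop7CubeCutoffGeometry.exists_cubeCutoffs`' COARSE support row (12)
# to the FINE radius the axial gauge of [Balaban1985RegularSpaces] Lemma 1 needs, and hence the two flatness letters `hUV` (bondwise, `W_c` versus `1` on `supp χ`) and `hflat`
# (block flatness of `W_c` on the blocks meeting `supp χ`) of ✓p755265 ∕ ✓p757348 ∕ ✓p759867 at the cube-gauged background `W_c := (axialT U₀ c)·U₀`, with EXPLICIT `K`-free slopes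

Cell `ym3-torus` (HUMAN RULING D-0037: YM₃ on T³ is ladder rung R3 — NOT d = 4, NOT infinite volume, NOT a mass gap, NOT Clay).  Width seat `ym-routeR-w3` (gen 13); chair
★`ym-ust-19200-p1` g25 CHAIR WORD №2 (iii) «GO — routeR-w3 takes the per-cube discharge of ✓p760402's `hRB1`∕`hRB2`∕`hop`»; routeR-w2 g13 ✓p760971 «(12) is the support radius for
`hUV`∕`hflat` — USE BY NAME (routeR-w3 g13)».  THEOREMS ONLY (0 `def`, 0 `sorry`); `--supports stmt-QuantumFields-19200 --as helper`, count-neutral.  HONEST LABEL (★★OWNER RULING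
№33 (6)): lattice bookkeeping; nothing of `hloc` at the member, `hlarge`, `hT`, `hGF`, EX or the crux is proved here.

THE POINT.  ✓`exists_cubeCutoffs` (routeR-w2 g13) builds the cube cut-offs from a block-distance weight and reports the support of `χ` in COARSE units: row (12)
`χ x ≠ 0 → ∃ y ∈ T₀, tdist (B^k x) y − 3 < Bc∕ν`.  The cube-gauge flatness of ✓`Prop7LODCubeGaugeFamily.norm_gaugeAct_axialT_sub_one_le_of_tdist` (routeR-w4 g26;
`‖U₀^{σ_c}(b) − 1‖ ≤ 2a₀·tdist(c, b₋)` for non-wrapping bonds, `a₀ = regThreshold = ε₀η²`) needs the FINE distance `tdist(c, x)`.  The tree has the fine → coarse contraction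
✓`Prop7BlockDistanceWeights.tdist_iterBlockOf_le`; §1 supplies the converse through the block CENTRES: `tdist (embIter Y) (embIter Y′) = L^k·tdist Y Y′` EXACTLY (the least residue of
`L^k·(p − q)` modulo `L^k·M` is `L^k` times the least residue of `p − q` modulo `M`, `ZMod.valMinAbs_spec`), hence `tdist x x′ ≤ L^k·tdist (B^k x) (B^k x′) + 2d(L^k − 1)`.

WHAT IS PROVED (ns `…Theorems.Prop7CubeCutoffFlatness`).
* §1 (any `Params`, standing range `k ≤ m + K`) ★★ `tdist_embIter_eq` · ★ `tdist_le_pow_mul_tdist_iterBlockOf`.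
* §2 (member `F`, `k = K − n`, centre `c`, any finite coarse set `T₀` within coarse radius `RT` of `B^k c`) ★ `tdist_le_of_cutoff_row` — row (12) ⟹ `tdist c x ≤ L^k·(RT + Bc∕ν + 3) + 6(L^k − 1)`
  for every `x ∈ supp χ`; `tdist_blocks_T₀_le` — the `T₀` of ✓p760402 (`{z | ∃ z′, tdist z′ (B^k c) ≤ 3L^s + 4 ∧ tdist z′ z < r}`) has `RT = 3L^s + 4 + r`.
* §3 (`U₀ ∈ RegPr F n K ε₀`, `W_c := GaugeField.gaugeAct (axialT U₀ c) U₀`, one no-wrap hypothesis `hwrap`) ★★★ `hUV_cubeGauge` — `(χ b₊ ≠ 0 ∨ χ b₋ ≠ 0) →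
  ‖W_c♭(b) − 1♭(b)‖ ≤ δ·η` with `δ := 2ε₀·η·(R + 1)` (so `δ ≤ 2ε₀(RT + Bc∕ν + 11)`, `K`-free: `hδ_le`); ★★★ `hflat_cubeGauge` — on every block meeting `supp χ` every inner bond has
  `‖W_c♭(b) − 1‖ ≤ δ′ := 2·regThreshold·(R + 3(L^k − 1))`; ★ `hflat_cubeGauge_of_plateau` — the same for `χt` under row (6) `χt x ≠ 0 → χ x = 1`.
HONEST SCOPE.  Geometry and the axial-gauge flatness letter only; the comb-frame rows, massive rows, windows, and the three px5-class rows themselves are STAGES RB∕OP.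

References: T. Bałaban, CMP **99** (1985) 75–102 [Balaban1985RegularSpaces] (Lemma 1 (1.24)–(1.25) p.79); CMP **109** (1987) 249–301 [Balaban1987RG1] ((0.1)–(0.3) pp.251–252);
CMP **98** (1985) 17–51 [Balaban1985Averaging] ((2) p.17, pp.24–25); CMP **102** (1985) 277–309 [Balaban1985Variational] ((2), (6) p.278).
-/

set_option autoImplicit false

noncomputable section

open scoped BigOperators Matrix.Norms.L2Operator Matrix

namespace Summit.QuantumFields.YangMills.Theorems.Prop7CubeCutoffFlatness

open Literature.MathematicalPhysics.QuantumFieldTheory.Balaban1983to89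
open Literature.MathematicalPhysics.QuantumFieldTheory.Balaban1983to89.T3ContinuumYM3Torus
open B5Eq118OneStroke (iterBlockOf iterBlock mem_iterBlock)
open B15DeterminingSets (embIter)
open B10Eq27TorusAxialLog (axialT)
open B3Taylor310LocalRemainder (tdist_comm tdist_triangle tdist_eq_sum_natAbs)
open B13BondAveragingReadingNumerals (tdist_embIter_le_of_mem_iterBlock)
open T3PrintedRegularMinimiser (RegPr)
open T3RegularMinimiser (regThreshold regThreshold_pos)
open T3SectALandauChart (eta eta_pos bgUnits bgUnits_one)
open Summit.QuantumFields.YangMills.BalabanUVNodes.N20LCSHullSeparation (val_embIter_eq_pow_mul_add)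
open Summit.QuantumFields.YangMills.Theorems.Prop7BlockDistanceWeights (tdist_le_of_iterBlockOf_eq tdist_src_tgt_le_one tdist_coarse_comm tdist_coarse_triangle eta_mul_pow_eq_one)
open Summit.QuantumFields.YangMills.Theorems.Prop7LODCubeGaugeFamily (norm_gaugeAct_axialT_sub_one_le_of_tdist)

/-! ## §1 Block centres are `L^k`-dilated: the coarse → fine distance conversion -/

section Centres

variable {P : Params}

/-- The least residue of `L·u` modulo `L·M` is `L` times the least residue of `u` modulo `M`. [folklore] -/
theorem valMinAbs_mul_eq {M ℓ : ℕ} [NeZero M] [NeZero (ℓ * M)] (hℓ : 0 < ℓ) (a : ZMod M) :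
    (((ℓ : ℤ) * (a.valMinAbs : ℤ) : ℤ) : ZMod (ℓ * M)).valMinAbs = (ℓ : ℤ) * a.valMinAbs := by
  rw [ZMod.valMinAbs_spec]
  refine ⟨rfl, ?_⟩
  have h := (ZMod.valMinAbs_spec a a.valMinAbs).mp rfl
  obtain ⟨h1, h2⟩ := h.2
  constructor
  · push_cast; nlinarith
  · push_cast; nlinarith

/-- ★★ **BLOCK CENTRES ARE `L^k`-DILATED**: `tdist (embIter k y) (embIter k y′) = L^k · tdist y y′` (`k ≤ m + K`; centre labels `L^k·y_ν + off`, ✓`val_embIter_eq_pow_mul_add`; per coordinate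
the least residue of `L^k(p − q)` modulo `L^k·M` is `L^k` times that of `p − q` modulo `M`). [cite: Balaban1987RG1, (0.1) p.251; Balaban1984PropagatorsI, (1.18) p.20] -/
theorem tdist_embIter_eq {k : ℕ} (hk : k ≤ P.m + P.K) (y y' : Site P k) :
    Site.tdist (embIter k y) (embIter k y') = P.L ^ k * Site.tdist y y' := by
  classical
  obtain ⟨off, hoff⟩ := val_embIter_eq_pow_mul_add (P := P) hk
  set ℓ : ℕ := P.L ^ k with hℓ
  set M : ℕ := P.sitesPerDir k with hM
  set N : ℕ := P.sitesPerDir 0 with hN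
  have hNM : N = ℓ * M := B5Eq117TorusCarriers.sitesPerDir_zero_eq hk
  have hℓ0 : 0 < ℓ := pow_pos P.L_pos k
  haveI : NeZero M := ⟨P.sitesPerDir_ne_zero k⟩
  haveI : NeZero N := ⟨P.sitesPerDir_ne_zero 0⟩
  haveI : NeZero (ℓ * M) := ⟨by rw [← hNM]; exact P.sitesPerDir_ne_zero 0⟩
  rw [tdist_eq_sum_natAbs, tdist_eq_sum_natAbs, Finset.mul_sum]
  refine Finset.sum_congr rfl fun ν _ => ?_
  -- the coordinate difference of the centres is `ℓ·(p − q)` in `ZMod N`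
  set a : ZMod M := y ν - y' ν with ha
  have hdiff : (embIter k y ν - embIter k y' ν : ZMod N) = (((ℓ : ℤ) * (a.valMinAbs : ℤ) : ℤ) : ZMod N) := by
    have e1 : (embIter k y ν : ZMod N) = ((ℓ * (y ν).val + off : ℕ) : ZMod N) := by
      rw [← ZMod.natCast_zmod_val (embIter k y ν), hoff y ν]
    have e2 : (embIter k y' ν : ZMod N) = ((ℓ * (y' ν).val + off : ℕ) : ZMod N) := by
      rw [← ZMod.natCast_zmod_val (embIter k y' ν), hoff y' ν]
    -- `a.valMinAbs ≡ p − q (mod M)`, so `ℓ·a.valMinAbs ≡ ℓ(p − q) (mod N)`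
    have hmod : ((a.valMinAbs : ℤ) : ZMod M) = (((y ν).val : ℤ) - ((y' ν).val : ℤ) : ℤ) := by
      rw [ZMod.coe_valMinAbs, ha]
      push_cast
      rw [ZMod.natCast_zmod_val, ZMod.natCast_zmod_val]
    obtain ⟨t, ht⟩ := (ZMod.intCast_eq_intCast_iff_dvd_sub _ _ M).mp hmod.symm
    have hN' : ((N : ℕ) : ℤ) ∣ (ℓ : ℤ) * (a.valMinAbs : ℤ) - (ℓ : ℤ) * (((y ν).val : ℤ) - ((y' ν).val : ℤ)) := by
      refine ⟨t, ?_⟩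
      rw [hNM]; push_cast
      rw [← mul_sub, ht]; ring
    rw [e1, e2]
    have : (((ℓ * (y ν).val + off : ℕ) : ℤ) : ZMod N) - (((ℓ * (y' ν).val + off : ℕ) : ℤ) : ZMod N) = (((ℓ : ℤ) * (a.valMinAbs : ℤ) : ℤ) : ZMod N) := by
      rw [← Int.cast_sub, ZMod.intCast_eq_intCast_iff_dvd_sub]
      push_cast
      have : (ℓ : ℤ) * (a.valMinAbs : ℤ) - ((ℓ : ℤ) * ((y ν).val : ℤ) + (off : ℤ) - ((ℓ : ℤ) * ((y' ν).val : ℤ) + (off : ℤ)))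
          = (ℓ : ℤ) * (a.valMinAbs : ℤ) - (ℓ : ℤ) * (((y ν).val : ℤ) - ((y' ν).val : ℤ)) := by ring
      rw [this]; exact hN'
    simpa using this
  rw [hdiff]
  have hv : ((((ℓ : ℤ) * (a.valMinAbs : ℤ) : ℤ) : ZMod N).valMinAbs) = (ℓ : ℤ) * a.valMinAbs := by
    have := valMinAbs_mul_eq (M := M) hℓ0 a
    rw [← hNM] at this
    convert this using 2
  rw [hv, Int.natAbs_mul, Int.natAbs_natCast]

/-- ★ **COARSE → FINE**: `tdist x x′ ≤ L^k·tdist (B^k x) (B^k x′) + 2·d·(L^k − 1)` (through the two block centres: ✓`tdist_embIter_le_of_mem_iterBlock` twice and §1).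
[cite: Balaban1987RG1, (0.1)–(0.3) pp.251–252; Balaban1985Averaging, (2) p.17] -/
theorem tdist_le_pow_mul_tdist_iterBlockOf {k : ℕ} (hk : k ≤ P.m + P.K) (x x' : Site P 0) :
    Site.tdist x x' ≤ P.L ^ k * Site.tdist (iterBlockOf k x) (iterBlockOf k x') + 2 * (P.d * (P.L ^ k - 1)) := by
  have h1 : Site.tdist x (embIter k (iterBlockOf k x)) ≤ P.d * (P.L ^ k - 1) := by
    rw [tdist_comm]
    exact tdist_embIter_le_of_mem_iterBlock hk ((mem_iterBlock k _ x).mpr rfl)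
  have h2 : Site.tdist (embIter k (iterBlockOf k x')) x' ≤ P.d * (P.L ^ k - 1) :=
    tdist_embIter_le_of_mem_iterBlock hk ((mem_iterBlock k _ x').mpr rfl)
  have h3 := tdist_embIter_eq hk (iterBlockOf k x) (iterBlockOf k x')
  calc Site.tdist x x' ≤ Site.tdist x (embIter k (iterBlockOf k x)) + Site.tdist (embIter k (iterBlockOf k x)) x' := tdist_triangle _ _ _
    _ ≤ Site.tdist x (embIter k (iterBlockOf k x)) + (Site.tdist (embIter k (iterBlockOf k x)) (embIter k (iterBlockOf k x')) + Site.tdist (embIter k (iterBlockOf k x')) x') :=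
        Nat.add_le_add_left (tdist_triangle _ _ _) _
    _ ≤ P.d * (P.L ^ k - 1) + (P.L ^ k * Site.tdist (iterBlockOf k x) (iterBlockOf k x') + P.d * (P.L ^ k - 1)) := by
        rw [h3]; exact Nat.add_le_add h1 (Nat.add_le_add_left h2 _)
    _ = P.L ^ k * Site.tdist (iterBlockOf k x) (iterBlockOf k x') + 2 * (P.d * (P.L ^ k - 1)) := by ring

end Centres

/-! ## §2 The cube cut-off's support radius in fine units -/

section Radius

variable (F : T3Family) {n K : ℕ} (hnK : n ≤ K)

include hnK in
/-- ★ **ROW (12) ⟹ THE FINE RADIUS**: if every `x ∈ supp χ` has its block within `Bc∕ν + 3` of a block of `T₀`, and `T₀` lies within coarse radius `RT` of the centre block `B^k c`,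
then `tdist c x ≤ L^k·(RT + Bc∕ν + 3) + 6·(L^k − 1)` (d = 3). [cite: Balaban1987RG1, (0.1)–(0.3) pp.251–252; Balaban1985RegularSpaces, Lemma 1 p.79] -/
theorem tdist_le_of_cutoff_row (c : Site (F.P K) 0) (T₀ : Finset (Site (F.P K) (K - n))) {RT : ℝ}
    (hT₀ : ∀ y ∈ T₀, (Site.tdist (iterBlockOf (K - n) c) y : ℝ) ≤ RT)
    (χ : Site (F.P K) 0 → ℝ) {Bc ν : ℝ}
    (h12 : ∀ x, χ x ≠ 0 → ∃ y ∈ T₀, (Site.tdist (iterBlockOf (K - n) x) y : ℝ) - 3 < Bc / ν)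
    (x : Site (F.P K) 0) (hx : χ x ≠ 0) :
    (Site.tdist c x : ℝ) ≤ (F.L : ℝ) ^ (K - n) * (RT + Bc / ν + 3) + 6 * ((F.L : ℝ) ^ (K - n) - 1) := by
  have hk : K - n ≤ (F.P K).m + (F.P K).K := by show K - n ≤ F.m + K; have := F.hm; omega
  obtain ⟨y, hy, hxy⟩ := h12 x hx
  have hcoarse : (Site.tdist (iterBlockOf (K - n) c) (iterBlockOf (K - n) x) : ℝ) ≤ RT + Bc / ν + 3 := by
    have h1 := tdist_coarse_triangle F (iterBlockOf (K - n) c) y (iterBlockOf (K - n) x)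
    have h2 := tdist_coarse_comm F y (iterBlockOf (K - n) x)
    have h3 := hT₀ y hy
    linarith
  have hfine := tdist_le_pow_mul_tdist_iterBlockOf hk c x
  have hL1 : 1 ≤ F.L ^ (K - n) := Nat.one_le_pow _ _ (by have := F.hL.2; omega)
  have hcast : (Site.tdist c x : ℝ) ≤ ((F.P K).L : ℝ) ^ (K - n) * (Site.tdist (iterBlockOf (K - n) c) (iterBlockOf (K - n) x) : ℝ) + 2 * ((F.P K).d * (((F.P K).L : ℝ) ^ (K - n) - 1)) := by
    have : ((F.P K).L ^ (K - n) - 1 : ℕ) = ((F.P K).L : ℝ) ^ (K - n) - 1 := by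
      rw [Nat.cast_sub (Nat.one_le_pow _ _ (F.P K).L_pos)]; push_cast; ring
    have h := (Nat.cast_le (α := ℝ)).mpr hfine
    push_cast at h
    rw [Nat.cast_sub (Nat.one_le_pow _ _ (F.P K).L_pos)] at h
    push_cast at h
    linarith
  have hd : ((F.P K).d : ℝ) = 3 := by norm_num [T3Family.P_d]
  have hL : ((F.P K).L : ℝ) = (F.L : ℝ) := by rfl
  rw [hd, hL] at hcast
  have hℓ0 : (0 : ℝ) ≤ (F.L : ℝ) ^ (K - n) := by positivity
  nlinarith [mul_le_mul_of_nonneg_left hcoarse hℓ0]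

/-- **THE `T₀` OF ✓p760402 HAS COARSE RADIUS `3L^s + 4 + r`**: a block within `r` of `S_c = {z | tdist z (B^k c) ≤ 3L^s + 4}` is within `3L^s + 4 + r` of `B^k c` (the membership
predicate of ✓p760402's `hop`, read as a radius). [cite: Balaban1985BackgroundPropagators, (3.105) p.414] -/
theorem tdist_blocks_T₀_le (c : Site (F.P K) 0) (s : ℕ) (r : ℝ) (y : Site (F.P K) (K - n))
    (hy : ∃ z' ∈ (Finset.univ.filter fun z : Site (F.P K) (K - n) => Site.tdist z (iterBlockOf (K - n) c) ≤ 3 * F.L ^ s + 4), (Site.tdist (P := F.P K) z' y : ℝ) < r) :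
    (Site.tdist (iterBlockOf (K - n) c) y : ℝ) ≤ 3 * (F.L : ℝ) ^ s + 4 + r := by
  obtain ⟨z', hz', hzy⟩ := hy
  have hz'c : Site.tdist z' (iterBlockOf (K - n) c) ≤ 3 * F.L ^ s + 4 := (Finset.mem_filter.mp hz').2
  have h1 := tdist_coarse_triangle F (iterBlockOf (K - n) c) z' y
  have h2 := tdist_coarse_comm F (iterBlockOf (K - n) c) z'
  have h3 : (Site.tdist z' (iterBlockOf (K - n) c) : ℝ) ≤ 3 * (F.L : ℝ) ^ s + 4 := by exact_mod_cast hz'c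
  linarith

end Radius

/-! ## §3 The flatness letters of the cube-gauged background on the cut-off's support -/

section Flatness

variable (F : T3Family) {n K : ℕ} {ε₀ : ℝ} (hε₀ : 0 < ε₀)
  (U₀ : GaugeField (F.P K) 0 (Matrix.specialUnitaryGroup (Fin 2) ℂ)) (hreg : RegPr F n K ε₀ U₀) (c : Site (F.P K) 0)
  (χ : Site (F.P K) 0 → ℝ) {R : ℕ} (hR : ∀ x, χ x ≠ 0 → Site.tdist c x ≤ R)
  (hwrap : 2 * (R + 3 * (F.L ^ (K - n) - 1) + 2) ≤ (F.P K).sitesPerDir 0)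

/-- The cube-gauged bond variable read in units: `↑((W_c)♭ b) = ↑(W_c b)` and `↑(1♭ b) = 1`. [cite: Balaban1985Averaging, (19) p.21] -/
theorem norm_bgUnits_gaugeAct_sub_bgUnits_one_eq (b : PBond (F.P K) 0) :
    ‖((bgUnits F K (GaugeField.gaugeAct (axialT U₀ c) U₀) b : (Matrix (Fin 2) (Fin 2) ℂ)ˣ) : Matrix (Fin 2) (Fin 2) ℂ)
        - ((bgUnits F K (1 : GaugeField (F.P K) 0 (Matrix.specialUnitaryGroup (Fin 2) ℂ)) b : (Matrix (Fin 2) (Fin 2) ℂ)ˣ) : Matrix (Fin 2) (Fin 2) ℂ)‖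
      = ‖((GaugeField.gaugeAct (axialT U₀ c) U₀ b : Matrix.specialUnitaryGroup (Fin 2) ℂ) : Matrix (Fin 2) (Fin 2) ℂ) - 1‖ := by
  rw [bgUnits_one]
  rfl

include hε₀ hreg hR hwrap in
/-- ★★★ **`hUV` AT THE CUBE**: for every bond touching `supp χ`, `‖(W_c)♭(b) − 1♭(b)‖ ≤ δ·η` with `δ := 2·ε₀·η·(R + 1)` — [Balaban1985RegularSpaces] Lemma 1 in the axial gauge based at the
centre (✓`norm_gaugeAct_axialT_sub_one_le_of_tdist`, `a₀ = regThreshold = ε₀η²`), radius `R + 1` (a bond whose TARGET is in `supp χ` has its source within `R + 1`).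
[cite: Balaban1985RegularSpaces, Lemma 1 (1.24)–(1.25) p.79; Balaban1985Variational, (2), (6) p.278] -/
theorem hUV_cubeGauge (b : PBond (F.P K) 0) (hb : χ b.tgt ≠ 0 ∨ χ b.src ≠ 0) :
    ‖((bgUnits F K (GaugeField.gaugeAct (axialT U₀ c) U₀) b : (Matrix (Fin 2) (Fin 2) ℂ)ˣ) : Matrix (Fin 2) (Fin 2) ℂ)
        - ((bgUnits F K (1 : GaugeField (F.P K) 0 (Matrix.specialUnitaryGroup (Fin 2) ℂ)) b : (Matrix (Fin 2) (Fin 2) ℂ)ˣ) : Matrix (Fin 2) (Fin 2) ℂ)‖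
      ≤ (2 * ε₀ * eta F n K * ((R : ℝ) + 1)) * eta F n K := by
  rw [norm_bgUnits_gaugeAct_sub_bgUnits_one_eq F U₀ c]
  have hsrc : Site.tdist c b.src ≤ R + 1 := by
    rcases hb with h | h
    · have h1 := hR b.tgt h
      have h2 := tdist_triangle c b.tgt b.src
      have h3 : Site.tdist b.tgt b.src ≤ 1 := by rw [tdist_comm]; exact tdist_src_tgt_le_one b
      omega
    · exact (hR b.src h).trans (Nat.le_succ _)
  have hmain := norm_gaugeAct_axialT_sub_one_le_of_tdist U₀ (regThreshold_pos F (n := n) (K := K) hε₀) hreg.plaqSmall c b hsrc (by omega)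
  have hthr : regThreshold F n K ε₀ = ε₀ * (eta F n K) ^ 2 := by
    rw [T3RegularMinimiser.regThreshold, T3SectALandauChart.eta, ← pow_mul, mul_comm 2]
  rw [hthr] at hmain
  refine hmain.trans (le_of_eq ?_)
  push_cast
  ring

include hε₀ in
/-- ★ **THE SLOPE IS `K`-FREE**: `δ = 2ε₀·η·(R + 1) ≤ 2ε₀·(R′ + 1)` whenever `R ≤ L^{K−n}·R′` (`η·L^{K−n} = 1`, `η ≤ 1`). [cite: Balaban1985Variational, (2) p.278] -/
theorem delta_le_of_radius_le {R' : ℝ} (hR' : (R : ℝ) ≤ (F.L : ℝ) ^ (K - n) * R') :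
    2 * ε₀ * eta F n K * ((R : ℝ) + 1) ≤ 2 * ε₀ * (R' + 1) := by
  have hη := eta_pos F n K
  have hη1 : eta F n K ≤ 1 := by
    rw [T3SectALandauChart.eta]
    exact pow_le_one₀ (inv_nonneg.mpr (Nat.cast_nonneg _)) (inv_le_one_of_one_le₀ (by have := F.hL.2; exact_mod_cast this.le))
  have hone := eta_mul_pow_eq_one F (n := n) (K := K)
  have h1 : eta F n K * (R : ℝ) ≤ R' := by
    calc eta F n K * (R : ℝ) ≤ eta F n K * ((F.L : ℝ) ^ (K - n) * R') := mul_le_mul_of_nonneg_left hR' hη.le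
      _ = R' := by rw [← mul_assoc, hone, one_mul]
  have h2 : eta F n K * ((R : ℝ) + 1) ≤ R' + 1 := by nlinarith
  calc 2 * ε₀ * eta F n K * ((R : ℝ) + 1) = 2 * ε₀ * (eta F n K * ((R : ℝ) + 1)) := by ring
    _ ≤ 2 * ε₀ * (R' + 1) := mul_le_mul_of_nonneg_left h2 (by positivity)

include hε₀ hreg hR hwrap in
/-- ★★★ **`hflat` AT THE CUBE**: on every block meeting `supp χ`, every bond with both endpoints in the block has `‖(W_c)♭(b) − 1‖ ≤ δ′`, `δ′ := 2·regThreshold·(R + 3(L^{K−n} − 1))`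
(a bond of a block containing a point of `supp χ` has its source within `R + 3(L^k − 1)` of the centre, ✓`tdist_le_of_iterBlockOf_eq`). [cite: Balaban1985RegularSpaces, Lemma 1 p.79; Balaban1985Averaging, (2) p.17] -/
theorem hflat_cubeGauge (Y : Site (F.P K) (K - n)) (hY : ∃ x ∈ iterBlock (K - n) Y, χ x ≠ 0) (b : PBond (F.P K) 0)
    (hbs : iterBlockOf (K - n) b.src = Y) (_hbt : iterBlockOf (K - n) b.tgt = Y) :
    ‖((bgUnits F K (GaugeField.gaugeAct (axialT U₀ c) U₀) b : (Matrix (Fin 2) (Fin 2) ℂ)ˣ) : Matrix (Fin 2) (Fin 2) ℂ) - 1‖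
      ≤ 2 * regThreshold F n K ε₀ * ((R : ℝ) + 3 * ((F.L : ℝ) ^ (K - n) - 1)) := by
  have hk : K - n ≤ (F.P K).m + (F.P K).K := by show K - n ≤ F.m + K; have := F.hm; omega
  obtain ⟨x, hx, hχx⟩ := hY
  have hxY : iterBlockOf (K - n) x = Y := (mem_iterBlock (K - n) Y x).mp hx
  have hxb : Site.tdist x b.src ≤ (F.P K).d * ((F.P K).L ^ (K - n) - 1) := tdist_le_of_iterBlockOf_eq hk (hxY.trans hbs.symm)
  have hd : (F.P K).d = 3 := rfl
  have hL : (F.P K).L = F.L := rfl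
  rw [hd, hL] at hxb
  have hsrc : Site.tdist c b.src ≤ R + 3 * (F.L ^ (K - n) - 1) := (tdist_triangle c x b.src).trans (Nat.add_le_add (hR x hχx) hxb)
  have hmain := norm_gaugeAct_axialT_sub_one_le_of_tdist U₀ (regThreshold_pos F (n := n) (K := K) hε₀) hreg.plaqSmall c b hsrc (by omega)
  have hval : ((bgUnits F K (GaugeField.gaugeAct (axialT U₀ c) U₀) b : (Matrix (Fin 2) (Fin 2) ℂ)ˣ) : Matrix (Fin 2) (Fin 2) ℂ)
      = ((GaugeField.gaugeAct (axialT U₀ c) U₀ b : Matrix.specialUnitaryGroup (Fin 2) ℂ) : Matrix (Fin 2) (Fin 2) ℂ) := rfl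
  rw [hval]
  refine hmain.trans (le_of_eq ?_)
  rw [Nat.cast_add, Nat.cast_mul, Nat.cast_sub (Nat.one_le_pow _ _ (by have := F.hL.2; omega))]
  push_cast
  ring

include hε₀ hreg hwrap in
/-- ★ **THE SAME FOR THE PLATEAU CUT-OFF `χt`** (row (6): `χt x ≠ 0 → χ x = 1`): `supp χt ⊆ supp χ`, so `hflat` holds on the blocks meeting `supp χt` with the same `δ′`.
[cite: Balaban1985RegularSpaces, Lemma 1 p.79] -/
theorem hflat_cubeGauge_of_plateau (hRχ : ∀ x, χ x ≠ 0 → Site.tdist c x ≤ R) (χt : Site (F.P K) 0 → ℝ) (hplat : ∀ x, χt x ≠ 0 → χ x = 1)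
    (Y : Site (F.P K) (K - n)) (hY : ∃ x ∈ iterBlock (K - n) Y, χt x ≠ 0) (b : PBond (F.P K) 0)
    (hbs : iterBlockOf (K - n) b.src = Y) (hbt : iterBlockOf (K - n) b.tgt = Y) :
    ‖((bgUnits F K (GaugeField.gaugeAct (axialT U₀ c) U₀) b : (Matrix (Fin 2) (Fin 2) ℂ)ˣ) : Matrix (Fin 2) (Fin 2) ℂ) - 1‖
      ≤ 2 * regThreshold F n K ε₀ * ((R : ℝ) + 3 * ((F.L : ℝ) ^ (K - n) - 1)) := by
  obtain ⟨x, hx, hχt⟩ := hY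
  exact hflat_cubeGauge F hε₀ U₀ hreg c χ hRχ hwrap Y ⟨x, hx, by rw [hplat x hχt]; exact one_ne_zero⟩ b hbs hbt

include hε₀ in
/-- ★ **THE BLOCK SLOPE IS `K`-FREE TOO**: `δ′ = 2·regThreshold·(R + 3(L^k − 1)) ≤ 2ε₀·η·(R′ + 3)` whenever `R ≤ L^{K−n}·R′` (`regThreshold = ε₀η²`, `η·L^k = 1`); in particular the
frame-row condition `4·m·δ′ ≤ 1` with `m ≤ 3·L^k` follows from `24·ε₀·(R′ + 3) ≤ 1`. [cite: Balaban1985Variational, (2), (6) p.278] -/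
theorem deltaFlat_le_of_radius_le {R' : ℝ} (hR' : (R : ℝ) ≤ (F.L : ℝ) ^ (K - n) * R') :
    2 * regThreshold F n K ε₀ * ((R : ℝ) + 3 * ((F.L : ℝ) ^ (K - n) - 1)) ≤ 2 * ε₀ * eta F n K * (R' + 3) := by
  have hη := eta_pos F n K
  have hone := eta_mul_pow_eq_one F (n := n) (K := K)
  have hthr : regThreshold F n K ε₀ = ε₀ * (eta F n K) ^ 2 := by
    rw [T3RegularMinimiser.regThreshold, T3SectALandauChart.eta, ← pow_mul, mul_comm 2]
  rw [hthr]
  have hℓ0 : (0 : ℝ) < (F.L : ℝ) ^ (K - n) := by have := F.hL.2; positivity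
  -- `η·(R + 3(ℓ − 1)) ≤ η·ℓ·(R′ + 3) = R′ + 3`
  have h1 : eta F n K * ((R : ℝ) + 3 * ((F.L : ℝ) ^ (K - n) - 1)) ≤ R' + 3 := by
    have : (R : ℝ) + 3 * ((F.L : ℝ) ^ (K - n) - 1) ≤ (F.L : ℝ) ^ (K - n) * (R' + 3) := by nlinarith
    calc eta F n K * ((R : ℝ) + 3 * ((F.L : ℝ) ^ (K - n) - 1)) ≤ eta F n K * ((F.L : ℝ) ^ (K - n) * (R' + 3)) := mul_le_mul_of_nonneg_left this hη.le
      _ = R' + 3 := by rw [← mul_assoc, hone, one_mul]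
  calc 2 * (ε₀ * eta F n K ^ 2) * ((R : ℝ) + 3 * ((F.L : ℝ) ^ (K - n) - 1))
      = (2 * ε₀ * eta F n K) * (eta F n K * ((R : ℝ) + 3 * ((F.L : ℝ) ^ (K - n) - 1))) := by ring
    _ ≤ (2 * ε₀ * eta F n K) * (R' + 3) := mul_le_mul_of_nonneg_left h1 (by positivity)
    _ = 2 * ε₀ * eta F n K * (R' + 3) := by ring

end Flatness

end Summit.QuantumFields.YangMills.Theorems.Prop7CubeCutoffFlatness

end
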